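import Summits.BirchSwinnertonDyer.BirchSwinnertonDyer.Theorems.EisensteinPrimesBSDpOnCellCTelescopeBranchIsogenyOfIntertwiner
import Summits.BirchSwinnertonDyer.BirchSwinnertonDyer.Theorems.EisensteinPrimesBSDpOnCellCTelescopeBranchCofreeMemberAdapter
import Literature.NumberTheory.EllipticCurves.OrdinaryNewformDatumSelfDualTwist
import HarnessLib

/-!
# [telescope — width x2-p2 g23, 2026-08-30] THE MEMBER COLUMN CLOSED: rational CONJUGACY of a framed ℤ_p-representation `M₁` to the member's
# self-dual datum over `K_t` (+ (rat)) ⟹ the member ISOGENY `(ℚ_p/ℤ_p)² → A_{g_t}†` of leaf N1♭ (semilinear over `ℤ_p → 𝒪_t`, intertwining `M₁`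
# with `Δ.selfDualCofreeRep`, finite kernel and cokernel) — T-GAL's (G-fib_t) ∧ (G-rat) feed (fd_k♭-rem) with no further input
# Crux 4 `BSDpOnCellC` (stmt-BirchSwinnertonDyer-19034), line «telescope», leaf N1 (`--supports`, helper; closes nothing)

WHY: composition of three landed bricks — ideator g41's H3 `TelescopeBranchIntegralIntertwinerMember.exists_descent_and_integral_intertwiner` (descent
of the datum to ℤ_p-matrices `M₂` + integral intertwiner `Q, Q'`, `Q' M₁ = M₂ Q'`, `Q Q' = Q' Q = p^c`), this seat's #4
`TelescopeBranchIsogenyOfIntertwiner.exists_isogeny_of_intertwiner` / `mulVec_intertwines` (⟹ isogeny `e_{Q'}` of `(ℚ_p/ℤ_p)ⁿ` intertwining `M₁` with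
`M₂`) and #8 `TelescopeBranchCofreeMemberAdapter.exists_cofreeAdapter` (`(ℚ_p/ℤ_p)ⁿ ≅ Cofree ρ' F` under (rat), `M₂ ↦ g •`). The output is EXACTLY the
member isogeny clause of N1♭-rem over `Γ_ℚ` (this seat's #7 `TelescopeBranchLatticeRestrict.branchLattice_conclusion_of_framed_rat`, hypothesis `hfd`),
resp. of the ideator's T-GAL bridge §4 (fd_k♭).

CONTENT (namespace `…Theorems.TelescopeBranchMemberIsogenyOfConj`; THEOREMS ONLY): **`exists_isogeny_of_conj`** (generic framed `ρ' : G → GL_n(𝒪_t)`, action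
`g •` on `Cofree ρ' F`) and **`exists_member_isogeny_of_conj`** (specialised to `Δ.selfDualRep`, action written `Δ.selfDualCofreeRep σ`).

HONEST FRAMING: composition only; constructs no Galois representation; closes no registered stub, no crux, no summit statement; BSD is proved for no
curve by this file. No named fact, no definition, no instance, no `sorry`.
References (shape only): [cite: Hida1986, Thm. 2.1 (2.2c) ("π mod P is equivalent to π(f_P)")] [cite: Greenberg1989, §1 p. 98]
-/

set_option autoImplicit false
set_option linter.dupNamespace false

noncomputable section

open scoped Classical MatrixGroups
open Finset
open Literature.NumberTheory.EllipticCurves Literature.NumberTheory.EllipticCurves.GreenbergSelmer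
  Literature.NumberTheory.EllipticCurves.ModularForms Literature.NumberTheory.GaloisRepresentations Literature.NumberTheory.IwasawaTheory
  Summit.BirchSwinnertonDyer.BirchSwinnertonDyer.Theorems.TelescopeBranchIsogenyOfIntertwiner
  Summit.BirchSwinnertonDyer.BirchSwinnertonDyer.Theorems.TelescopeBranchCofreeMemberAdapter

namespace Summit.BirchSwinnertonDyer.BirchSwinnertonDyer.Theorems.TelescopeBranchMemberIsogenyOfConj

universe u

variable {Γ₀ : Subgroup (GL (Fin 2) ℝ)} {k : ℤ} {g : CuspForm Γ₀ k} {p : ℕ} [Fact p.Prime] (ι : coeffField g →+* PadicAlgCl p)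
  {G : Type u} [Group G] [TopologicalSpace G] {n : ℕ}

set_option maxHeartbeats 1600000 in
set_option synthInstance.maxHeartbeats 80000 in
/-- **Rational conjugacy ⟹ isogeny of cofree modules** (generic framed `ρ' : G → GL_n(𝒪_t)`, `𝒪_t = padicCoeffIntegers ι`, under (rat)): if the
ℤ_p-matrices `M₁ g` are conjugate over `K_t = padicCoeffField ι` to `ρ' g` (`M₁ g = P ρ' g P⁻¹` after the embeddings), THERE IS an additive
`e : (ℚ_p/ℤ_p)ⁿ → Cofree ρ' K_t`, semilinear over `algebraMap ℤ_p 𝒪_t`, with `e (M₁ g · v) = g • e v`, finite kernel and finite cokernel.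
[cite: Hida1986, Thm. 2.1 (2.2c)] [cite: Greenberg1989, §1 p. 98] -/
theorem exists_isogeny_of_conj (hrat : Function.Surjective (algebraMap ℤ_[p] (padicCoeffIntegers ι)))
    (ρ' : FramedRep G (padicCoeffIntegers ι) n) (M₁ : G → Matrix (Fin n) (Fin n) ℤ_[p]) (P : GL (Fin n) (padicCoeffField ι))
    (h : ∀ g, (M₁ g).map (fun z : ℤ_[p] => algebraMap ℚ_[p] (padicCoeffField ι) (z : ℚ_[p])) =
      (P : Matrix (Fin n) (Fin n) (padicCoeffField ι)) *
        ((ρ' g : GL (Fin n) (padicCoeffIntegers ι)) : Matrix (Fin n) (Fin n) (padicCoeffIntegers ι)).map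
          ((↑) : padicCoeffIntegers ι → padicCoeffField ι) *
        ((P⁻¹ : GL (Fin n) (padicCoeffField ι)) : Matrix (Fin n) (Fin n) (padicCoeffField ι))) :
    ∃ e : (Fin n → QpModZp p) →+ Cofree ρ' (padicCoeffField ι),
      (∀ (c : ℤ_[p]) (v : Fin n → QpModZp p), e (c • v) = algebraMap ℤ_[p] (padicCoeffIntegers ι) c • e v) ∧
      (∀ (g : G) (v : Fin n → QpModZp p), e (fun i ↦ ∑ j, M₁ g i j • v j) = g • e v) ∧
      Finite e.ker ∧ Finite (Cofree ρ' (padicCoeffField ι) ⧸ e.range) := by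
  -- H3: descent of `ρ'` to ℤ_p-matrices `M₂` and the integral intertwiner `Q, Q'`
  obtain ⟨M₂, Q, Q', c, hM₂, hQQ', hQ'Q, hint⟩ :=
    TelescopeBranchIntegralIntertwinerMember.exists_descent_and_integral_intertwiner ι hrat M₁
      (fun g ↦ ((ρ' g : GL (Fin n) (padicCoeffIntegers ι)) : Matrix (Fin n) (Fin n) (padicCoeffIntegers ι))) P h
  -- #4: the isogeny `e_{Q'}` of `(ℚ_p/ℤ_p)ⁿ` intertwining `M₁` with `M₂` (`M₂ g * Q' = Q' * M₁ g`)
  obtain ⟨e₁, he₁, he₁lin, he₁ker, he₁surj⟩ := exists_isogeny_of_intertwiner (p := p) Q' Q hQ'Q hQQ'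
  have he₁eq : ∀ (g : G) (v : Fin n → QpModZp p), e₁ (fun i ↦ ∑ j, M₁ g i j • v j) = fun i ↦ ∑ j, M₂ g i j • e₁ v j :=
    mulVec_intertwines M₂ M₁ Q' (fun g ↦ ((hint g).2).symm) e₁ he₁
  -- #8: `(ℚ_p/ℤ_p)ⁿ ≅ Cofree ρ' F`, `M₂ ↦ g •`
  obtain ⟨t, -, htlin, htinj, htsurj, hteq⟩ := exists_cofreeAdapter ι hrat ρ'
  refine ⟨t.comp e₁, fun c v ↦ ?_, fun g v ↦ ?_, ?_, ?_⟩
  · rw [AddMonoidHom.comp_apply, AddMonoidHom.comp_apply, he₁lin, htlin]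
  · rw [AddMonoidHom.comp_apply, AddMonoidHom.comp_apply, he₁eq, hteq g (M₂ g) (hM₂ g)]
  · exact finite_ker_comp_of_injective e₁ t he₁ker htinj
  · exact finite_quotient_of_surjective _ (htsurj.comp he₁surj)

set_option maxHeartbeats 1600000 in
set_option synthInstance.maxHeartbeats 80000 in
/-- **The member column of leaf N1♭, closed from T-GAL's (G-fib_t) ∧ (G-rat)**: for the member datum `Δ : OrdinaryNewformDatum g p ι` with (rat), a
family of ℤ_p-matrices `M σ` conjugate over `K_t` to the self-dual datum `Δ.selfDualRep σ` gives the isogeny `e : (ℚ_p/ℤ_p)² → A_g† = Cofree Δ.selfDualRep K_t`,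
semilinear over `ℤ_p → 𝒪_t`, with `e (M σ · v) = Δ.selfDualCofreeRep σ (e v)`, finite kernel and finite cokernel — the ℚ-level member clause of
`TelescopeBranchLatticeRestrict.branchLattice_conclusion_of_framed_rat` (then `fdk_restrict_rem` for `Γ_K`). [cite: Hida1986, Thm. 2.1 (2.2c)] -/
theorem exists_member_isogeny_of_conj {M' : ℕ} {k' : ℤ} {g' : CuspForm (CongruenceSubgroup.Gamma0 M') k'} {ι' : coeffField g' →+* PadicAlgCl p}
    (Δ : OrdinaryNewformDatum g' p ι') (hrat : Function.Surjective (algebraMap ℤ_[p] (padicCoeffIntegers ι')))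
    (M : Field.absoluteGaloisGroup ℚ → Matrix (Fin 2) (Fin 2) ℤ_[p]) (P : GL (Fin 2) (padicCoeffField ι'))
    (h : ∀ σ, (M σ).map (fun z : ℤ_[p] => algebraMap ℚ_[p] (padicCoeffField ι') (z : ℚ_[p])) =
      (P : Matrix (Fin 2) (Fin 2) (padicCoeffField ι')) *
        ((Δ.selfDualRep σ : GL (Fin 2) (padicCoeffIntegers ι')) : Matrix (Fin 2) (Fin 2) (padicCoeffIntegers ι')).map
          ((↑) : padicCoeffIntegers ι' → padicCoeffField ι') *
        ((P⁻¹ : GL (Fin 2) (padicCoeffField ι')) : Matrix (Fin 2) (Fin 2) (padicCoeffField ι'))) :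
    ∃ e : (Fin 2 → QpModZp p) →+ Cofree Δ.selfDualRep (padicCoeffField ι'),
      (∀ (c : ℤ_[p]) (v : Fin 2 → QpModZp p), e (c • v) = algebraMap ℤ_[p] (padicCoeffIntegers ι') c • e v) ∧
      (∀ (σ : Field.absoluteGaloisGroup ℚ) (v : Fin 2 → QpModZp p), e (fun i ↦ ∑ j, M σ i j • v j) = Δ.selfDualCofreeRep σ (e v)) ∧
      Finite e.ker ∧ Finite (Cofree Δ.selfDualRep (padicCoeffField ι') ⧸ e.range) :=
  exists_isogeny_of_conj ι' hrat Δ.selfDualRep M P h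

end Summit.BirchSwinnertonDyer.BirchSwinnertonDyer.Theorems.TelescopeBranchMemberIsogenyOfConj

end
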